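import Summits.Ventures.PercRepro.C041TriangleStarMarks

/-!
# THE RAYS AGAINST ANY STAR — `θ_△(e_{T₁}, V b)` and `θ_△(e_{T₂}, V b)` in the cone for EVERY pure root `V b`, every number
of leaves (mine-3, gen 61; C-041.md §21 (ao))

The first statement of the row that is UNIFORM in the number of leaves.  The ray `e_{T₁} = (0, 1, 0, 0, 0, 0)` has
`θ_B e_{T₁} = e_{T₁} + e₄`, `θ_R e_{T₁} = e₁₂₃`, `ℓψ e_{T₁} = v 1`, so for ANY zone `w`
`θ_△(e_{T₁}, w) = v 1 * w + (n + L₁)·v 1 + 2L₁·e_{T₁} − T₂·e₄ = v 1 * U` with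
`U = w + n·1 + L₁·v 1 − T₂·e₄` — and since `v 1` kills the coordinates `M₀`, `M₂`, the cone membership of `θ_△(e_{T₁}, w)`
is a TRUNCATED MOMENT PROBLEM on the leaf curve `x ↦ (1, 1 + x², 1 + (1 − x)², x)`: `U` agrees in the coordinates
`L₀, L₁, L₂, M₁` with `2M₁·1 + ∫ v x dμ(x)` for any measure `μ ≥ 0` on `[0, 1]` with moments
`m₀ = 2L₁ + L₂ − 2M₁`, `m₁ = 2L₁ − M₁`, `m₂ = 2L₁ − L₀`.  The two-atom measure `(m₀ − m₁²/m₂)·δ₀ + (m₁²/m₂)·δ_{m₂/m₁}`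
has these moments (`thetaTri_eT1_moment`, an identity valid for every `w`), and it is a measure on `[0, 1]` exactly when
`m₂ ≤ m₁` (`M₁ ≤ L₀`) and `m₀ m₂ ≥ m₁²`, i.e. `(2L₁ − L₀)(L₂ − L₀) ≥ (L₀ − M₁)²`.  For a star `V b` this is
**(R′)** `(1 − ∏ b)² ≤ (∏ (1 + b²)) · (∏ (1 + (1 − b)²) − 1)` (`star_moment_ineq`, by induction on the leaves: peel
`x = b_last`, `1 − Ax = x(1 − A) + (1 − x)`, one AM–GM).  THEOREMS `InCone_thetaTri_eT1_V` / `InCone_thetaTri_eT2_V`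
(the mirror, with the atoms `v 1` and `v (1 − m₂′/m₁′)`), for every `m` and every `b ∈ [0, 1]^m`.
-/

namespace PercRepro

namespace RelaxedTriangle

open TreeClosure Finset

/-- **(R′)**: for `b ∈ [0, 1]^m`, `(1 − ∏ b)² ≤ (∏ (1 + b²)) · (∏ (1 + (1 − b)²) − 1)`. -/
theorem star_moment_ineq {m : ℕ} (b : Fin m → ℝ) (hb : ∀ i, 0 ≤ b i ∧ b i ≤ 1) :
    (1 - ∏ i, b i) ^ 2 ≤ (∏ i, (1 + b i ^ 2)) * (∏ i, (1 + (1 - b i) ^ 2) - 1) := by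
  induction m with
  | zero => simp
  | succ n ih =>
    rw [Fin.prod_univ_castSucc, Fin.prod_univ_castSucc, Fin.prod_univ_castSucc]
    have hQ := ih (fun i => b (Fin.castSucc i)) (fun i => hb _)
    set A := ∏ i : Fin n, b (Fin.castSucc i) with hA
    set P1 := ∏ i : Fin n, (1 + b (Fin.castSucc i) ^ 2) with hP1
    set P2 := ∏ i : Fin n, (1 + (1 - b (Fin.castSucc i)) ^ 2) with hP2
    set x := b (Fin.last n) with hx
    have hx0 : 0 ≤ x := (hb _).1
    have hx1 : x ≤ 1 := (hb _).2
    have hA0 : 0 ≤ A := Finset.prod_nonneg (fun i _ => (hb _).1)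
    have hA1 : A ≤ 1 := Finset.prod_le_one (fun i _ => (hb _).1) (fun i _ => (hb _).2)
    have hP1' : 1 ≤ P1 := Finset.one_le_prod (fun i _ => by nlinarith [sq_nonneg (b (Fin.castSucc i))])
    have hP2' : 1 ≤ P2 := Finset.one_le_prod (fun i _ => by nlinarith [sq_nonneg (1 - b (Fin.castSucc i))])
    have hPP : 1 ≤ P1 * P2 := one_le_mul_of_one_le_of_one_le hP1' hP2'
    have e1 : (1 - A * x) ^ 2 = x ^ 2 * (1 - A) ^ 2 + 2 * (x * (1 - x)) * (1 - A) + (1 - x) ^ 2 := by ring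
    have e2 : 2 * (x * (1 - x)) * (1 - A) ≤ (x * (1 - x)) ^ 2 + (1 - A) ^ 2 := by
      nlinarith [sq_nonneg (x * (1 - x) - (1 - A))]
    have f1 : x ^ 2 * (1 - A) ^ 2 ≤ x ^ 2 * (P1 * (P2 - 1)) := mul_le_mul_of_nonneg_left hQ (sq_nonneg x)
    have f2 : (x * (1 - x)) ^ 2 ≤ P1 * P2 * (x * (1 - x)) ^ 2 := by
      nlinarith [mul_nonneg (sub_nonneg.2 hPP) (sq_nonneg (x * (1 - x)))]
    have f3 : (1 - x) ^ 2 ≤ P1 * P2 * (1 - x) ^ 2 := by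
      nlinarith [mul_nonneg (sub_nonneg.2 hPP) (sq_nonneg (1 - x))]
    have e3 : P1 * (1 + x ^ 2) * (P2 * (1 + (1 - x) ^ 2) - 1)
        = P1 * (P2 - 1) + x ^ 2 * (P1 * (P2 - 1)) + P1 * P2 * (1 - x) ^ 2 + P1 * P2 * (x * (1 - x)) ^ 2 := by ring
    rw [e1, e3]
    linarith [hQ, e2, f1, f2, f3]

/-- **THE RAY `e_{T₁}` AGAINST ANY ZONE, IN MOMENT FORM**: with `m₀ = 2L₁ + L₂ − 2M₁`, `m₁ = 2L₁ − M₁`, `m₂ = 2L₁ − L₀`,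
`θ_△(e_{T₁}, w) = v 1 * (2M₁·1 + (m₀ − m₁²/m₂)·v 0 + (m₁²/m₂)·v (m₂/m₁))` — an identity of six-vectors for every `w`
with `m₁, m₂ ≠ 0`. -/
theorem thetaTri_eT1_moment (w : Vec6) (h1 : 2 * w 1 - w 4 ≠ 0) (h2 : 2 * w 1 - w 0 ≠ 0) :
    thetaTri ![0, 1, 0, 0, 0, 0] w
      = v 1 * ((2 * w 4) • (1 : Vec6)
        + ((2 * w 1 + w 2 - 2 * w 4) - (2 * w 1 - w 4) ^ 2 / (2 * w 1 - w 0)) • v 0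
        + ((2 * w 1 - w 4) ^ 2 / (2 * w 1 - w 0)) • v ((2 * w 1 - w 0) / (2 * w 1 - w 4))) := by
  have h1' : w 1 * 2 - w 4 ≠ 0 := by rw [mul_comm]; exact h1
  have h2' : w 1 * 2 - w 0 ≠ 0 := by rw [mul_comm]; exact h2
  ext i
  simp only [thetaTri_eq_vec, Pi.add_apply, Pi.smul_apply, Pi.mul_apply, Pi.one_apply, smul_eq_mul, v]
  fin_cases i <;> simp <;> field_simp <;> ring

/-- The mirror: `θ_△(e_{T₂}, w) = v 0 * (2M₂·1 + (m₀′ − m₁′²/m₂′)·v 1 + (m₁′²/m₂′)·v (1 − m₂′/m₁′))` with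
`m₀′ = 2L₂ + L₁ − 2M₂`, `m₁′ = 2L₂ − M₂`, `m₂′ = 2L₂ − L₀`. -/
theorem thetaTri_eT2_moment (w : Vec6) (h1 : 2 * w 2 - w 5 ≠ 0) (h2 : 2 * w 2 - w 0 ≠ 0) :
    thetaTri ![0, 0, 1, 0, 0, 0] w
      = v 0 * ((2 * w 5) • (1 : Vec6)
        + ((2 * w 2 + w 1 - 2 * w 5) - (2 * w 2 - w 5) ^ 2 / (2 * w 2 - w 0)) • v 1
        + ((2 * w 2 - w 5) ^ 2 / (2 * w 2 - w 0)) • v (1 - (2 * w 2 - w 0) / (2 * w 2 - w 5))) := by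
  have h1' : w 2 * 2 - w 5 ≠ 0 := by rw [mul_comm]; exact h1
  have h2' : w 2 * 2 - w 0 ≠ 0 := by rw [mul_comm]; exact h2
  ext i
  simp only [thetaTri_eq_vec, Pi.add_apply, Pi.smul_apply, Pi.mul_apply, Pi.one_apply, smul_eq_mul, v]
  fin_cases i <;> simp <;> field_simp <;> ring

/-- The coordinates of a star. -/
theorem V_coords {m : ℕ} (b : Fin m → ℝ) :
    V b 0 = 1 ∧ V b 1 = ∏ i, (1 + b i ^ 2) ∧ V b 2 = ∏ i, (1 + (1 - b i) ^ 2) ∧ V b 4 = ∏ i, b i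
      ∧ V b 5 = ∏ i, (1 - b i) := by
  refine ⟨?_, ?_, ?_, ?_, ?_⟩ <;> simp [V_apply, v]

/-- **THEOREM (THE RAY `e_{T₁}` AGAINST ANY STAR)**: for every `m` and every `b ∈ [0, 1]^m`,
`θ_△(e_{T₁}, V b)` lies in the cone. -/
theorem InCone_thetaTri_eT1_V {m : ℕ} (b : Fin m → ℝ) (hb : ∀ i, 0 ≤ b i ∧ b i ≤ 1) :
    InCone (thetaTri ![0, 1, 0, 0, 0, 0] (V b)) := by
  obtain ⟨h0, h1, h2, h4, -⟩ := V_coords b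
  have hA0 : 0 ≤ V b 4 := by rw [h4]; exact Finset.prod_nonneg (fun i _ => (hb i).1)
  have hA1 : V b 4 ≤ 1 := by rw [h4]; exact Finset.prod_le_one (fun i _ => (hb i).1) (fun i _ => (hb i).2)
  have hP1 : 1 ≤ V b 1 := by rw [h1]; exact Finset.one_le_prod (fun i _ => by nlinarith [sq_nonneg (b i)])
  have hP2 : 1 ≤ V b 2 := by rw [h2]; exact Finset.one_le_prod (fun i _ => by nlinarith [sq_nonneg (1 - b i)])
  have hR : (1 - V b 4) ^ 2 ≤ V b 1 * (V b 2 - 1) := by rw [h1, h2, h4]; exact star_moment_ineq b hb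
  have hm1 : 0 < 2 * V b 1 - V b 4 := by linarith
  have hm2 : 0 < 2 * V b 1 - V b 0 := by rw [h0]; linarith
  rw [thetaTri_eT1_moment (V b) hm1.ne' hm2.ne']
  refine InCone_v1.mul (((InCone.smul _ (by positivity) InCone_one).add (InCone.smul _ ?_ InCone_v0)).add
    (InCone.smul _ (by positivity) (InCone_v _ ⟨by positivity, ?_⟩)))
  · rw [sub_nonneg, div_le_iff₀ hm2, h0]
    nlinarith [hR, mul_nonneg (sub_nonneg.2 hP1) (sub_nonneg.2 hP2)]
  · rw [div_le_one hm1, h0]; linarith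

/-- **THEOREM (THE RAY `e_{T₂}` AGAINST ANY STAR)**: the mirror. -/
theorem InCone_thetaTri_eT2_V {m : ℕ} (b : Fin m → ℝ) (hb : ∀ i, 0 ≤ b i ∧ b i ≤ 1) :
    InCone (thetaTri ![0, 0, 1, 0, 0, 0] (V b)) := by
  obtain ⟨h0, h1, h2, -, h5⟩ := V_coords b
  have hB0 : 0 ≤ V b 5 := by rw [h5]; exact Finset.prod_nonneg (fun i _ => by linarith [(hb i).2])
  have hB1 : V b 5 ≤ 1 := by
    rw [h5]; exact Finset.prod_le_one (fun i _ => by linarith [(hb i).2]) (fun i _ => by linarith [(hb i).1])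
  have hP1 : 1 ≤ V b 1 := by rw [h1]; exact Finset.one_le_prod (fun i _ => by nlinarith [sq_nonneg (b i)])
  have hP2 : 1 ≤ V b 2 := by rw [h2]; exact Finset.one_le_prod (fun i _ => by nlinarith [sq_nonneg (1 - b i)])
  have hR : (1 - V b 5) ^ 2 ≤ V b 2 * (V b 1 - 1) := by
    have := star_moment_ineq (fun i => 1 - b i) (fun i => ⟨by linarith [(hb i).2], by linarith [(hb i).1]⟩)
    simp only [sub_sub_cancel] at this
    rw [h1, h2, h5]; exact this
  have hm1 : 0 < 2 * V b 2 - V b 5 := by linarith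
  have hm2 : 0 < 2 * V b 2 - V b 0 := by rw [h0]; linarith
  rw [thetaTri_eT2_moment (V b) hm1.ne' hm2.ne']
  refine InCone_v0.mul (((InCone.smul _ (by positivity) InCone_one).add (InCone.smul _ ?_ InCone_v1)).add
    (InCone.smul _ (by positivity) (InCone_v _ ⟨?_, ?_⟩)))
  · rw [sub_nonneg, div_le_iff₀ hm2, h0]
    nlinarith [hR, mul_nonneg (sub_nonneg.2 hP1) (sub_nonneg.2 hP2)]
  · rw [sub_nonneg, div_le_one hm1, h0]; linarith
  · have : 0 ≤ (2 * V b 2 - V b 0) / (2 * V b 2 - V b 5) := by positivity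
    linarith

/-! ## The marked vertices from the seeds and the rays -/

/-- `X(p,0) = v 1 + sh p • e_{T₁}` for `p ≥ 1`. -/
theorem pow_v_one_eq_add (p : ℕ) (hp : 1 ≤ p) : v 1 ^ p = v 1 + sh p • ![0, 1, 0, 0, 0, 0] := by
  rw [pow_v_one_eq p hp]
  ext i
  simp only [Pi.add_apply, Pi.smul_apply, smul_eq_mul, v, sh]
  fin_cases i <;> simp
  ring

/-- `X(0,q) = v 0 + sh q • e_{T₂}` for `q ≥ 1`. -/
theorem pow_v_zero_eq_add (q : ℕ) (hq : 1 ≤ q) : v 0 ^ q = v 0 + sh q • ![0, 0, 1, 0, 0, 0] := by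
  rw [pow_v_zero_eq q hq]
  ext i
  simp only [Pi.add_apply, Pi.smul_apply, smul_eq_mul, v, sh]
  fin_cases i <;> simp
  ring

/-- **FROM THE SEEDS TO EVERY MARKED VERTEX**: if the (1,1)-vertex, the single marks and the two rays give cone members
against `w′ ∈ cone`, then so does every marked vertex `X(p,q)`, `p, q ≥ 0`. -/
theorem InCone_thetaTri_marks_of_seeds {w' : Vec6} (hw' : InCone w') (h11 : InCone (thetaTri (v 1 * v 0) w'))
    (h1 : InCone (thetaTri (v 1) w')) (h0 : InCone (thetaTri (v 0) w'))
    (hT1 : InCone (thetaTri ![0, 1, 0, 0, 0, 0] w')) (hT2 : InCone (thetaTri ![0, 0, 1, 0, 0, 0] w')) (p q : ℕ) :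
    InCone (thetaTri (v 1 ^ p * v 0 ^ q) w') := by
  by_cases hp : p = 0
  · subst hp
    by_cases hq : q = 0
    · subst hq
      simp only [pow_zero, mul_one]
      rw [thetaTri_comm]
      exact InCone_thetaTri_one hw'
    · simp only [pow_zero, one_mul]
      rw [pow_v_zero_eq_add q (Nat.one_le_iff_ne_zero.mpr hq), thetaTri_add_left, thetaTri_smul_left]
      exact h0.add (hT2.smul _ (sh_nonneg q (Nat.one_le_iff_ne_zero.mpr hq)))
  · by_cases hq : q = 0
    · subst hq
      simp only [pow_zero, mul_one]
      rw [pow_v_one_eq_add p (Nat.one_le_iff_ne_zero.mpr hp), thetaTri_add_left, thetaTri_smul_left]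
      exact h1.add (hT1.smul _ (sh_nonneg p (Nat.one_le_iff_ne_zero.mpr hp)))
    · rw [pow_v_one_mul_pow_v_zero_eq_add p q (Nat.one_le_iff_ne_zero.mpr hp) (Nat.one_le_iff_ne_zero.mpr hq),
        thetaTri_add_left, thetaTri_add_left, thetaTri_smul_left, thetaTri_smul_left]
      exact (h11.add (hT1.smul _ (sh_nonneg p (Nat.one_le_iff_ne_zero.mpr hp)))).add
        (hT2.smul _ (sh_nonneg q (Nat.one_le_iff_ne_zero.mpr hq)))

/-- The pure roots are in the cone. -/
theorem InCone_V {m : ℕ} (b : Fin m → ℝ) (hb : ∀ i, 0 ≤ b i ∧ b i ≤ 1) : InCone (V b) := InCone.pure b hb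

/-- **EVERY MARKED VERTEX AGAINST ANY STAR, MODULO THE THREE SEEDS**: for a star `V b` the rays are settled
(`InCone_thetaTri_eT1_V` / `_eT2_V`), so `θ_△(X(p,q), V b) ∈ cone` for all `p, q` as soon as the (1,1)-vertex and the
two single marks against `V b` are. -/
theorem InCone_thetaTri_marks_V_of_seeds {m : ℕ} (b : Fin m → ℝ) (hb : ∀ i, 0 ≤ b i ∧ b i ≤ 1)
    (h11 : InCone (thetaTri (v 1 * v 0) (V b))) (h1 : InCone (thetaTri (v 1) (V b)))
    (h0 : InCone (thetaTri (v 0) (V b))) (p q : ℕ) : InCone (thetaTri (v 1 ^ p * v 0 ^ q) (V b)) :=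
  InCone_thetaTri_marks_of_seeds (InCone_V b hb) h11 h1 h0 (InCone_thetaTri_eT1_V b hb) (InCone_thetaTri_eT2_V b hb) p q

end RelaxedTriangle

end PercRepro
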